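import Summits.MatrixMultiplication.OmegaCensus.SmallFormats.EtaSpecialFinTwo
import Summits.MatrixMultiplication.OmegaCensus.SmallFormats.InvertiblePointNearLineColumns
import HarnessLib

/-!
# ω-census family (a): CASE B of a rank-one ω with a NON-η-special removed class is impossible — kernel form of desk law §8(a)

Cell `pub-omega` (unit `pub-omega-tensor-g26`), topic `Summits/MatrixMultiplication/OmegaCensus` (sub-folder `SmallFormats`).
Framing (verbatim): lottery ticket; floor = certified bounds/negative ranges. HONEST FRAMING: an elementary structural no-go over an arbitrary
field (`m = 2`), companion of `near_not_lineColumnShape_wide` (p501624) and of `InvertiblePointNearEtaSpecial` (p519828); it is the kernel form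
of the desk law `NEAR-STRUCTURE.md` §8(a) by which the tensor ω-engine (`kitjob-nearomega2`) closes 'case B' of the rank-one ω-classes whose
left vector `η` is NOT that of the removed class. No rank bound; nothing on `ω`.

**Statement (`near_caseB_removed_not_etaSpecial`).** Near-frame point of `⟨2,2,n⟩` (`X₀ = 1`, `|O| = 2n + 1`, frame data `ρ, σ, l, j₀` as in
`InvertiblePointNearFrame`), a line-column shape `J` (column `j ∈ J` of every `W_t`, `t ∉ O`, and of `W_{j₀}` on the line `k ζ_j`) with at least two
free columns and `|ι| ≤ 2n + 2|J|` (census: `20 ≤ 12 + 8`), a functional `η ≠ 0` on `k²` and a vector `b̂ ∈ kⁿ` with a nonzero free part such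
that `ω̂ := η ∘ (· b̂)` kills every `Z`-output (`η(W_t b̂) = 0`, `t ∉ O`) but NOT `Q = W_{j₀}` (`η(W_{j₀} b̂) ≠ 0`, 'case B'). Then the removed class
`c_{j₀} = f_{j₀}/f_{j₀}(1)` is η-special (`c_{j₀}(X) = η(X u)` for some `u`). Proof (§8(a)): by the ω-law every term is either an N-term
(`l_s = 0`, `W_s b̂ = 0`) or has `c_s ∈ R_η + k c_{j₀}`; all the latter vanish at `X⁺ := m ⊗ λ⁺` (`m` spans `ker η`, `c_{j₀}(X⁺) = 0`), so Brent's
column `b̂` at `X⁺` gives `λ⁺·(Y b̂) = 0` on `K₀ = ⋂_{t∉O} ker g_t`; the defect functionals `e(·,Y)` (`Y ∈ K₀`) lie in `R_η + k c_{j₀}` and vanish at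
`1`, so two evaluations kill them; hence `K₁ := {Y ∈ K₀ : e(·,Y) = 0, Y b̂ = 0}` has codimension `≤ |Z| + 3`, its line columns vanish
(`nearLineCol_eq`), so `K₁ =` the matrices supported on the free columns with `Y b̂ = 0` — nonzero, `X`-stable, with exact transport — and some `f_s`
would be multiplicative (`not_mul_hom_matrix_two`).
-/

namespace Summit.MatrixMultiplication.OmegaCensus.SmallFormats

open Module Matrix Literature.Computability.AlgebraicComplexity

variable {k : Type*} [Field k] {n : ℕ} {ι : Type*} [Fintype ι]

section CaseB

variable (β : BilinComp (mulBilin k 2 2 n) ι) (O : Finset ι)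

open Classical in
/-- **Law §8(a) of `NEAR-STRUCTURE.md`, kernel form (tensor g26).** At a near-frame point of `⟨2,2,n⟩` with a line-column shape `J` having at
least two free columns and `|ι| ≤ 2n + 2|J|` (`𝔽₃ ⟨2,2,6⟩@20`, T-type: `20 ≤ 12 + 8`): if `η ≠ 0` and `b̂ ∈ kⁿ` (nonzero on some free column)
are such that `ω̂ := η ∘ (· b̂)` kills every `W_t`, `t ∉ O`, but not `W_{j₀}` ('case B'), then the removed class `c_{j₀} = f_{j₀}/f_{j₀}(1)` is
η-special. Contrapositive = the engine's law (a): for `c_p` NOT η-special, case B of every ω with rank-one free part `η ⊗ b` and all line parts on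
columns with `η(ζ_q) ≠ 0` (absorbed into `b̂`) is impossible. -/
theorem near_caseB_removed_etaSpecial [DecidableEq ι] (hO : ∀ i, i ∉ O → β.f i 1 = 0) (hO' : ∀ i ∈ O, β.f i 1 ≠ 0)
    (hcard : O.card = 2 * n + 1) {ρ σ l : ι → k}
    (hM : ∀ s ∈ O, ∀ j ∈ O, β.f s 1 * β.g s (β.w j) = (if s = j then 1 else 0) + ρ s * σ j)
    (hρ : ∃ s ∈ O, ρ s ≠ 0) {j₀ : ι} (hj₀ : j₀ ∈ O) (hσ : σ j₀ ≠ 0) (hl : ∀ s ∈ O, σ s = l s * σ j₀) (hl₀ : l j₀ = 1)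
    (J : Finset (Fin n)) (ζ : Fin n → Fin 2 → k) (hζ : ∀ j ∈ J, ζ j ≠ 0) (hfree : J.card + 2 ≤ n)
    (hZ : Fintype.card ι ≤ 2 * n + 2 * J.card)
    (hT : ∀ t, t ∉ O → ∀ j ∈ J, ∃ c : k, ∀ r, β.w t r j = c * ζ j r)
    (w₀ : Fin n → k) (hQ : ∀ j ∈ J, ∀ r, β.w j₀ r j = w₀ j * ζ j r)
    (η : Module.Dual k (Fin 2 → k)) (hη : η ≠ 0) (bh : Fin n → k) {j₁ : Fin n} (hj₁J : j₁ ∉ J) (hbj₁ : bh j₁ ≠ 0)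
    (hv : ∀ t, t ∉ O → η (β.w t *ᵥ bh) = 0) (hK : η (β.w j₀ *ᵥ bh) ≠ 0) :
    ∃ u : Fin 2 → k, ∀ X, β.f j₀ X * (β.f j₀ 1)⁻¹ = η (X *ᵥ u) := by
  by_contra hp
  -- the removed class as a functional `cp`, a kernel vector `mv` of `η`, a unit vector `wη` (`η(wη) = 1`)
  let cp : Module.Dual k (Matrix (Fin 2) (Fin 2) k) := (β.f j₀ 1)⁻¹ • β.f j₀
  have hcp : ∀ X, cp X = β.f j₀ X * (β.f j₀ 1)⁻¹ := fun X => by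
    simp only [cp, LinearMap.smul_apply, smul_eq_mul, mul_comm]
  have hfj₀ : ∀ X, β.f j₀ X = β.f j₀ 1 * cp X := fun X => by
    rw [hcp, mul_comm, mul_assoc, inv_mul_cancel₀ (hO' j₀ hj₀), mul_one]
  have hcp1 : cp 1 = 1 := by rw [hcp, mul_inv_cancel₀ (hO' j₀ hj₀)]
  have hp' : ¬ ∃ u : Fin 2 → k, ∀ X, cp X = η (X *ᵥ u) := by
    rintro ⟨u, hu⟩; exact hp ⟨u, fun X => by rw [← hcp, hu]⟩
  obtain ⟨hm0, hηm⟩ := kerVec_spec η hη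
  set mv : Fin 2 → k := ![η (Pi.single 1 1), -η (Pi.single 0 1)] with hmv
  obtain ⟨wη, hwη⟩ := exists_apply_eq_one_of_ne_zero η hη
  have hmvX : ∀ lam u : Fin 2 → k, η (vecMulVec mv lam *ᵥ u) = 0 := fun lam u => by
    rw [vecMulVec_mulVec_eq_smul, map_smul, hηm, smul_zero]
  -- `X₁ = mv λ₁ᵀ` with `cp(X₁) ≠ 0` (cp is not η-special) and `X⁺ = mv λ⁺ᵀ ≠ 0` with `cp(X⁺) = 0`
  obtain ⟨lam₁, hlam₁⟩ := exists_vecMulVec_apply_ne_zero η hη hm0 hηm cp hp'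
  let θ : Module.Dual k (Fin 2 → k) :=
    { toFun := fun lam => cp (vecMulVec mv lam)
      map_add' := fun a b => by simp only [vecMulVec_add, map_add]
      map_smul' := fun r a => by simp only [vecMulVec_smul, map_smul, smul_eq_mul, RingHom.id_apply] }
  have hθapp : ∀ lam, θ lam = cp (vecMulVec mv lam) := fun lam => rfl
  have hθ : θ ≠ 0 := fun h => hlam₁ (by rw [← hθapp, h, LinearMap.zero_apply])
  obtain ⟨hlp0, hθlp⟩ := kerVec_spec θ hθ
  set lp : Fin 2 → k := ![θ (Pi.single 1 1), -θ (Pi.single 0 1)] with hlp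
  set Xp : Matrix (Fin 2) (Fin 2) k := vecMulVec mv lp with hXp
  have hcpXp : cp Xp = 0 := by rw [hXp, ← hθapp]; exact hθlp
  -- the functional `ω̂ = η ∘ (· b̂)`
  let ω : Module.Dual k (Matrix (Fin 2) (Fin n) k) := η.comp ((Matrix.mulVecBilin k k).flip bh)
  have hωapp : ∀ W, ω W = η (W *ᵥ bh) := fun W => eta_comp_mulVec_apply η bh W
  have hω : ∀ t, t ∉ O → ω (β.w t) = 0 := fun t ht => by rw [hωapp]; exact hv t ht
  -- STEP 1 (ω-law): every `s ∈ O` has `f_s(X⁺) = 0`, or is an N-term: `l_s = 0` and `W_s b̂ = 0`;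
  -- and `l_s f_s = η(· v_s) + c_s·cp` for explicit `v_s, c_s`.
  have hstep : ∀ s ∈ O, (β.f s Xp = 0 ∨ (l s = 0 ∧ β.w s *ᵥ bh = 0)) ∧
      ∃ vc : (Fin 2 → k) × k, ∀ X, l s * β.f s X = η (X *ᵥ vc.1) + vc.2 * cp X := by
    intro s hs
    by_cases hsj : s = j₀
    · subst hsj
      refine ⟨Or.inl (by rw [hfj₀, hcpXp, mul_zero]), ⟨(0, l s * β.f s 1), fun X => ?_⟩⟩
      rw [Matrix.mulVec_zero, map_zero, zero_add, hfj₀ X, mul_assoc]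
    have hlaw : ∀ X, η (X *ᵥ ((β.w s - l s • β.w j₀) *ᵥ bh)) -
        β.f s X * (β.f s 1)⁻¹ * (η (β.w s *ᵥ bh) - l s * η (β.w j₀ *ᵥ bh)) =
        η (β.w j₀ *ᵥ bh) * (l s * (β.f s X * (β.f s 1)⁻¹ - cp X)) := by
      intro X
      have h := omega_law_of_forall β O hO' hM hj₀ hs (hl s hs) X ω hω
      rw [hωapp, hωapp, hωapp, ← Matrix.mulVec_mulVec, Matrix.sub_mulVec, Matrix.smul_mulVec, map_sub, map_smul,
        smul_eq_mul, ← hcp] at h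
      rw [Matrix.sub_mulVec, Matrix.smul_mulVec]
      exact h
    by_cases hA : η (β.w s *ᵥ bh) = 0
    · -- N-term
      have hls : l s = 0 := by
        by_contra hls
        apply hp'
        refine ⟨(-(η (β.w j₀ *ᵥ bh) * l s))⁻¹ • ((β.w s - l s • β.w j₀) *ᵥ bh), fun X => ?_⟩
        have h := hlaw X
        rw [hA, zero_sub] at h
        rw [Matrix.mulVec_smul, map_smul, smul_eq_mul]
        have hne : -(η (β.w j₀ *ᵥ bh) * l s) ≠ 0 := neg_ne_zero.mpr (mul_ne_zero hK hls)
        field_simp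
        linear_combination h
      have hWb : β.w s *ᵥ bh = 0 := by
        funext i
        have h := hlaw (vecMulVec wη (Pi.single i 1))
        rw [hA, hls, zero_smul, sub_zero, zero_mul, sub_zero, mul_zero, zero_mul, mul_zero, sub_zero,
          eta_vecMulVec_single_mulVec η hwη] at h
        rw [h, Pi.zero_apply]
      refine ⟨Or.inr ⟨hls, hWb⟩, ⟨(0, 0), fun X => ?_⟩⟩
      rw [hls, zero_mul, Matrix.mulVec_zero, map_zero, zero_mul, add_zero]
    · -- S-term: `c_s(X)·A = η(X w') + K l cp(X)`
      have hcs : ∀ X, β.f s X * (β.f s 1)⁻¹ * η (β.w s *ᵥ bh) =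
          η (X *ᵥ ((β.w s - l s • β.w j₀) *ᵥ bh)) + η (β.w j₀ *ᵥ bh) * l s * cp X := fun X => by
        linear_combination -(hlaw X)
      refine ⟨Or.inl ?_, ⟨((l s * β.f s 1 * (η (β.w s *ᵥ bh))⁻¹) • ((β.w s - l s • β.w j₀) *ᵥ bh),
        l s * β.f s 1 * (η (β.w s *ᵥ bh))⁻¹ * (η (β.w j₀ *ᵥ bh) * l s)), fun X => ?_⟩⟩
      · have h := hcs Xp
        rw [hXp, hmvX, ← hXp, hcpXp, mul_zero, zero_add] at h
        rcases mul_eq_zero.mp h with h1 | h1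
        · rcases mul_eq_zero.mp h1 with h2 | h2
          · exact h2
          · exact absurd h2 (inv_ne_zero (hO' s hs))
        · exact absurd h1 hA
      · rw [Matrix.mulVec_smul, map_smul, smul_eq_mul]
        have h := hcs X
        have hfs : β.f s X = β.f s 1 * (η (β.w s *ᵥ bh))⁻¹ *
            (η (X *ᵥ ((β.w s - l s • β.w j₀) *ᵥ bh)) + η (β.w j₀ *ᵥ bh) * l s * cp X) := by
          rw [← h]; field_simp [hO' s hs, hA]
        rw [hfs]; ring
  -- STEP 2: `λ⁺ · (Y b̂) = 0` on `K₀` (Brent's column `b̂` at `X⁺`)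
  have hlpY : ∀ Y : Matrix (Fin 2) (Fin n) k, (∀ t, t ∉ O → β.g t Y = 0) → lp ⬝ᵥ (Y *ᵥ bh) = 0 := by
    intro Y hY
    have hB := β.map_eq_sum Xp Y
    rw [mulBilin_apply] at hB
    have h2 := congrArg (fun W : Matrix (Fin 2) (Fin n) k => ((Matrix.mulVecBilin k k).flip bh) W) hB
    simp only [map_sum, map_smul] at h2
    have hzero : ∀ i, (β.f i Xp * β.g i Y) • ((Matrix.mulVecBilin k k).flip bh) (β.w i) = 0 := by
      intro i
      by_cases hi : i ∈ O
      · rcases (hstep i hi).1 with h0 | ⟨_, h0⟩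
        · rw [h0, zero_mul, zero_smul]
        · have : ((Matrix.mulVecBilin k k).flip bh) (β.w i) = β.w i *ᵥ bh := by simp [Matrix.mulVecBilin_apply]
          rw [this, h0, smul_zero]
      · rw [hY i hi, mul_zero, zero_smul]
    rw [Finset.sum_eq_zero fun i _ => hzero i] at h2
    have h3 : (Xp * Y) *ᵥ bh = 0 := by simpa [Matrix.mulVecBilin_apply] using h2
    rw [← Matrix.mulVec_mulVec, hXp, vecMulVec_mulVec_eq_smul] at h3
    rcases smul_eq_zero.mp h3 with h4 | h4
    · exact h4
    · exact absurd h4 hm0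
  -- STEP 3: the defect functionals `e(·, W) = Σ l_s g_s(W) f_s` have the form `η(· wt) + ct·cp`
  choose! vc hvc using fun s (hs : s ∈ O) => (hstep s hs).2
  let eW : Matrix (Fin 2) (Fin 2) k → Module.Dual k (Matrix (Fin 2) (Fin n) k) :=
    fun X => ∑ s ∈ O, (l s * β.f s X) • β.g s
  have heW : ∀ X W, eW X W = ∑ s ∈ O, l s * (β.f s X * β.g s W) := fun X W => by
    simp only [eW, LinearMap.coe_sum, Finset.sum_apply, LinearMap.smul_apply, smul_eq_mul, mul_assoc]
  have heform : ∀ W X, ∑ s ∈ O, l s * (β.f s X * β.g s W) =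
      η (X *ᵥ ∑ s ∈ O, β.g s W • (vc s).1) + (∑ s ∈ O, β.g s W * (vc s).2) * cp X := by
    intro W X
    rw [Matrix.mulVec_sum, map_sum, Finset.sum_mul, ← Finset.sum_add_distrib]
    refine Finset.sum_congr rfl fun s hs => ?_
    rw [Matrix.mulVec_smul, map_smul, smul_eq_mul, show l s * (β.f s X * β.g s W) = β.g s W * (l s * β.f s X) by ring,
      hvc s hs X]
    ring
  -- pick `r₁` with `lp r₁ ≠ 0` and `i₀` with `mv i₀ ≠ 0`
  obtain ⟨r₁, hr₁⟩ : ∃ r, lp r ≠ 0 := by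
    by_contra h; push Not at h; exact hlp0 (funext h)
  obtain ⟨i₀, hi₀⟩ : ∃ i, mv i ≠ 0 := by
    by_contra h; push Not at h; exact hm0 (funext h)
  set X₁ : Matrix (Fin 2) (Fin 2) k := vecMulVec mv lam₁ with hX₁
  set X₂ : Matrix (Fin 2) (Fin 2) k := vecMulVec wη (Pi.single i₀ 1) with hX₂
  -- the three extra functionals cutting `K₁` out of `K₀`
  let φ₃ : Module.Dual k (Matrix (Fin 2) (Fin n) k) := (LinearMap.proj (r₁ + 1)).comp ((Matrix.mulVecBilin k k).flip bh)
  have hφ₃ : ∀ W, φ₃ W = (W *ᵥ bh) (r₁ + 1) := fun W => by simp [φ₃, Matrix.mulVecBilin_apply]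
  let F : Fin 3 → Module.Dual k (Matrix (Fin 2) (Fin n) k) := ![eW X₁, eW X₂, φ₃]
  set Zs : Finset ι := Finset.univ \ O with hZs
  let ψ : Matrix (Fin 2) (Fin n) k →ₗ[k] (Zs → k) × (Fin 3 → k) :=
    LinearMap.prod (LinearMap.pi fun t => β.g (t : ι)) (LinearMap.pi fun i => F i)
  set K₁ := LinearMap.ker ψ with hK₁
  have memK₁ : ∀ W, W ∈ K₁ ↔ (∀ t, t ∉ O → β.g t W = 0) ∧ ∀ i, F i W = 0 := fun W => by
    rw [hK₁, LinearMap.mem_ker, LinearMap.prod_apply, Prod.mk_eq_zero]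
    constructor
    · rintro ⟨h, h0⟩
      refine ⟨fun t ht => ?_, fun i => ?_⟩
      · have := congr_fun h ⟨t, Finset.mem_sdiff.mpr ⟨Finset.mem_univ t, ht⟩⟩
        simpa using this
      · have := congr_fun h0 i
        simpa using this
    · rintro ⟨h, h0⟩
      refine ⟨?_, ?_⟩
      · funext t; simpa using h t (Finset.mem_sdiff.mp t.2).2
      · funext i; simpa using h0 i
  -- on `K₁`: the defect vanishes at every `X`, and `W b̂ = 0`
  have he0 : ∀ W, W ∈ K₁ → ∀ X : Matrix (Fin 2) (Fin 2) k, ∑ s ∈ O, l s * (β.f s X * β.g s W) = 0 := by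
    intro W hW X
    obtain ⟨hWg, hWF⟩ := (memK₁ W).mp hW
    set wt : Fin 2 → k := ∑ s ∈ O, β.g s W • (vc s).1 with hwt
    set ct : k := ∑ s ∈ O, β.g s W * (vc s).2 with hct
    have h1 : η (X₁ *ᵥ wt) + ct * cp X₁ = 0 := by rw [← heform]; have := hWF 0; simpa [F, heW] using this
    have h2 : η (X₂ *ᵥ wt) + ct * cp X₂ = 0 := by rw [← heform]; have := hWF 1; simpa [F, heW] using this
    have h0 : η ((1 : Matrix (Fin 2) (Fin 2) k) *ᵥ wt) + ct * cp 1 = 0 := by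
      rw [← heform]; exact nearDefect_one β O hO hM hρ hσ hl W
    rw [hX₁, hmvX, zero_add] at h1
    have hct0 : ct = 0 := by
      rcases mul_eq_zero.mp h1 with h | h
      · exact h
      · exact absurd h hlam₁
    rw [hct0, zero_mul, add_zero, Matrix.one_mulVec] at h0
    rw [hct0, zero_mul, add_zero, hX₂, eta_vecMulVec_single_mulVec η hwη] at h2
    obtain ⟨t, ht⟩ := exists_smul_of_eta_eq_zero η hη hm0 hηm wt h0
    have ht0 : t = 0 := by
      have : t * mv i₀ = 0 := by have := congr_fun ht i₀; simp only [Pi.smul_apply, smul_eq_mul] at this; rw [← this, h2]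
      rcases mul_eq_zero.mp this with h | h
      · exact h
      · exact absurd h hi₀
    have hwt0 : wt = 0 := by rw [ht, ht0, zero_smul]
    rw [heform, ← hwt, ← hct, hwt0, hct0, Matrix.mulVec_zero, map_zero, zero_mul, add_zero]
  have hWb : ∀ W, W ∈ K₁ → W *ᵥ bh = 0 := by
    intro W hW
    obtain ⟨hWg, hWF⟩ := (memK₁ W).mp hW
    have h3 : (W *ᵥ bh) (r₁ + 1) = 0 := by rw [← hφ₃]; have := hWF 2; simpa [F] using this
    have hl' := hlpY W hWg
    simp only [dotProduct, Fin.sum_univ_two] at hl'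
    funext r
    rw [Pi.zero_apply]
    fin_cases r₁
    · fin_cases r
      · simp only [Fin.zero_eta] at hr₁ ⊢
        have h3' : (W *ᵥ bh) 1 = 0 := by simpa using h3
        rw [h3', mul_zero, add_zero] at hl'
        rcases mul_eq_zero.mp hl' with h | h
        · exact absurd h hr₁
        · exact h
      · simpa using h3
    · fin_cases r
      · simpa using h3
      · simp only [Fin.mk_one] at hr₁ ⊢
        have h3' : (W *ᵥ bh) 0 = 0 := by simpa using h3
        rw [h3', mul_zero, zero_add] at hl'
        rcases mul_eq_zero.mp hl' with h | h
        · exact absurd h hr₁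
        · exact h
  -- `M₀` = matrices supported on the free columns with `W b̂ = 0`, spanned by `single r j 1 − (b̂_j/b̂_{j₁}) single r j₁ 1`, `j` free, `j ≠ j₁`
  have hj₁mem : j₁ ∈ Finset.univ \ J := Finset.mem_sdiff.mpr ⟨Finset.mem_univ j₁, hj₁J⟩
  set Js : Finset (Fin n) := (Finset.univ \ J).erase j₁ with hJs
  have hJs_mem : ∀ j ∈ Js, j ≠ j₁ ∧ j ∉ J := fun j hj => by
    rw [hJs, Finset.mem_erase, Finset.mem_sdiff] at hj; exact ⟨hj.1, hj.2.2⟩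
  let b' : Fin 2 → Fin n → Matrix (Fin 2) (Fin n) k :=
    fun r j => single r j (1 : k) - (bh j * (bh j₁)⁻¹) • single r j₁ (1 : k)
  set M₀ := Submodule.span k (↑((Finset.univ ×ˢ Js).image fun p : Fin 2 × Fin n => b' p.1 p.2) :
    Set (Matrix (Fin 2) (Fin n) k)) with hM₀
  have hb'J : ∀ r j, j ∉ J → ∀ j' ∈ J, ∀ i, b' r j i j' = 0 := by
    intro r j hj j' hj' i
    have h1 : j ≠ j' := fun h => hj (h ▸ hj')
    have h2 : j₁ ≠ j' := fun h => hj₁J (h ▸ hj')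
    simp [b', h1, h2]
  have hb'bh : ∀ r j, b' r j *ᵥ bh = 0 := by
    intro r j
    have hsc : bh j * (bh j₁)⁻¹ * bh j₁ = bh j := by rw [mul_assoc, inv_mul_cancel₀ hbj₁, mul_one]
    rw [show b' r j = single r j 1 - (bh j * (bh j₁)⁻¹) • single r j₁ 1 from rfl, Matrix.sub_mulVec, Matrix.smul_mulVec,
      single_one_mulVec, single_one_mulVec, smul_smul, ← sub_smul, hsc, sub_self, zero_smul]
  have memM₀ : ∀ W : Matrix (Fin 2) (Fin n) k, (∀ j ∈ J, ∀ i, W i j = 0) → W *ᵥ bh = 0 → W ∈ M₀ := by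
    intro W hWJ hWbh
    have hcol : ∀ i, W i j₁ * bh j₁ = -∑ j ∈ Js, W i j * bh j := by
      intro i
      have h := congr_fun hWbh i
      simp only [mulVec, dotProduct, Pi.zero_apply] at h
      rw [← Finset.sum_sdiff (Finset.subset_univ J),
        show ∑ j ∈ J, W i j * bh j = 0 from Finset.sum_eq_zero fun j hj => by rw [hWJ j hj i, zero_mul], add_zero,
        ← Finset.add_sum_erase _ _ hj₁mem] at h
      linear_combination h
    have hW : W = ∑ i, ∑ j ∈ Js, W i j • b' i j := by
      ext i' c
      simp only [Matrix.sum_apply, Matrix.smul_apply, smul_eq_mul]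
      rw [Finset.sum_eq_single i' (fun i _ hi => Finset.sum_eq_zero fun j _ => by simp [b', hi]) (fun h => absurd (Finset.mem_univ i') h)]
      have hinner : ∀ j ∈ Js, W i' j * b' i' j i' c = (if j = c then W i' j else 0) - (if j₁ = c then W i' j * (bh j * (bh j₁)⁻¹) else 0) := by
        intro j _
        simp only [b', Matrix.sub_apply, Matrix.smul_apply, single_apply, smul_eq_mul, true_and, mul_sub, mul_ite, mul_one, mul_zero]
      rw [Finset.sum_congr rfl hinner, Finset.sum_sub_distrib, Finset.sum_ite_eq' Js c, Finset.sum_ite_irrel,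
        Finset.sum_const_zero]
      by_cases hcJ : c ∈ J
      · have hc1 : ¬ j₁ = c := fun h => hj₁J (h ▸ hcJ)
        have hcJs : c ∉ Js := fun h => (hJs_mem c h).2 hcJ
        rw [if_neg hcJs, if_neg hc1, sub_zero, hWJ c hcJ i']
      · by_cases hc1 : j₁ = c
        · subst hc1
          have hcJs : j₁ ∉ Js := fun h => (hJs_mem j₁ h).1 rfl
          rw [if_neg hcJs, if_pos rfl, zero_sub]
          have h := hcol i'
          have : W i' j₁ = -(∑ j ∈ Js, W i' j * bh j) * (bh j₁)⁻¹ := by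
            rw [← h, mul_assoc, mul_inv_cancel₀ hbj₁, mul_one]
          rw [this, neg_mul, Finset.sum_mul]
          congr 1
          exact Finset.sum_congr rfl fun j _ => by ring
        · have hcJs : c ∈ Js := by
            rw [hJs, Finset.mem_erase, Finset.mem_sdiff]; exact ⟨fun h => hc1 h.symm, Finset.mem_univ c, hcJ⟩
          rw [if_pos hcJs, if_neg hc1, sub_zero]
    rw [hW]
    refine Submodule.sum_mem _ fun i _ => Submodule.sum_mem _ fun j hj => Submodule.smul_mem _ _ (Submodule.subset_span ?_)
    rw [Finset.coe_image]
    exact ⟨(i, j), by simp [hj], rfl⟩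
  -- line columns of `K₁` vanish, so `K₁ ≤ M₀`
  have hK₁J : ∀ W, W ∈ K₁ → ∀ j ∈ J, ∀ i, W i j = 0 := by
    intro W hW j hj i
    obtain ⟨hWg, _⟩ := (memK₁ W).mp hW
    rw [nearLineCol_eq β O hO' hM hj₀ hl hl₀ (hζ j hj) (fun t ht => hT t ht j hj) (hQ j hj) hWg i, he0 W hW, mul_zero]
  have hle : K₁ ≤ M₀ := fun W hW => memM₀ W (hK₁J W hW) (hWb W hW)
  -- dimensions: `dim M₀ ≤ 2(n − |J| − 1) ≤ 4n − |ι| − 2 ≤ dim K₁`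
  have hJs_card : Js.card = n - J.card - 1 := by
    rw [hJs, Finset.card_erase_of_mem hj₁mem, Finset.card_sdiff, Finset.inter_univ, Finset.card_univ, Fintype.card_fin]
  have hdimM : finrank k M₀ ≤ 2 * (n - J.card - 1) := by
    calc finrank k M₀ ≤ ((Finset.univ ×ˢ Js).image fun p : Fin 2 × Fin n => b' p.1 p.2).card := finrank_span_finset_le_card _
      _ ≤ (Finset.univ ×ˢ Js).card := Finset.card_image_le
      _ = 2 * (n - J.card - 1) := by rw [Finset.card_product, Finset.card_univ, Fintype.card_fin, hJs_card]
  have hdimK : 2 * n ≤ finrank k K₁ + (Fintype.card ι - O.card + 3) := by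
    have h1 := LinearMap.finrank_range_add_finrank_ker ψ
    rw [finrank_matrix_fin, ← hK₁] at h1
    have h2 : finrank k (LinearMap.range ψ) ≤ Fintype.card ι - O.card + 3 := by
      calc finrank k (LinearMap.range ψ) ≤ finrank k ((Zs → k) × (Fin 3 → k)) := Submodule.finrank_le _
        _ = Fintype.card ι - O.card + 3 := by
            rw [Module.finrank_prod, finrank_fintype_fun_eq_card, finrank_fintype_fun_eq_card, Fintype.card_coe, hZs,
              Finset.card_sdiff, Finset.inter_univ, Finset.card_univ, Fintype.card_fin]
    omega
  have hOle : O.card ≤ Fintype.card ι := by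
    calc O.card ≤ (Finset.univ : Finset ι).card := Finset.card_le_card (Finset.subset_univ O)
      _ = Fintype.card ι := Finset.card_univ
  have hJn : J.card ≤ n := by omega
  have hKM : K₁ = M₀ := Submodule.eq_of_le_of_finrank_le hle (by omega)
  have hK₁_of : ∀ W : Matrix (Fin 2) (Fin n) k, (∀ j ∈ J, ∀ i, W i j = 0) → W *ᵥ bh = 0 → W ∈ K₁ :=
    fun W hWJ hWbh => hKM ▸ memM₀ W hWJ hWbh
  -- a test vector `W₁ := b'(0, j₂)` (`j₂` free, `≠ j₁`) and its left multiples lie in `M₀ = K₁`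
  have hJs_ne : Js.Nonempty := by rw [← Finset.card_pos, hJs_card]; omega
  obtain ⟨j₂, hj₂⟩ := hJs_ne
  obtain ⟨hj₂1, hj₂J⟩ := hJs_mem j₂ hj₂
  set W₁ : Matrix (Fin 2) (Fin n) k := b' 0 j₂ with hW₁
  have hW₁J : ∀ j ∈ J, ∀ i, W₁ i j = 0 := fun j hj i => hb'J 0 j₂ hj₂J j hj i
  have hW₁bh : W₁ *ᵥ bh = 0 := hb'bh 0 j₂
  have hmulJ : ∀ (X : Matrix (Fin 2) (Fin 2) k) (W : Matrix (Fin 2) (Fin n) k), (∀ j ∈ J, ∀ i, W i j = 0) →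
      ∀ j ∈ J, ∀ i, (X * W) i j = 0 := by
    intro X W hW j hj i
    rw [Matrix.mul_apply]
    exact Finset.sum_eq_zero fun r _ => by rw [hW j hj r, mul_zero]
  have hmulbh : ∀ (X : Matrix (Fin 2) (Fin 2) k) (W : Matrix (Fin 2) (Fin n) k), W *ᵥ bh = 0 → (X * W) *ᵥ bh = 0 :=
    fun X W hW => by rw [← Matrix.mulVec_mulVec, hW, Matrix.mulVec_zero]
  -- exact transport on `K₁`
  have htrans : ∀ W : Matrix (Fin 2) (Fin n) k, (∀ j ∈ J, ∀ i, W i j = 0) → W *ᵥ bh = 0 → ∀ s ∈ O, ∀ X : Matrix (Fin 2) (Fin 2) k,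
      β.f s 1 * β.g s (X * W) = β.f s X * β.g s W := by
    intro W hWJ hWbh s hs X
    have hKW := hK₁_of W hWJ hWbh
    obtain ⟨hWg, _⟩ := (memK₁ W).mp hKW
    rw [near_transport β O hM hWg hs X]
    have hσ' : ∑ s' ∈ O, σ s' * (β.f s' X * β.g s' W) = σ j₀ * ∑ s' ∈ O, l s' * (β.f s' X * β.g s' W) := by
      rw [Finset.mul_sum]
      exact Finset.sum_congr rfl fun s' hs' => by rw [hl s' hs']; ring
    rw [hσ', he0 W hKW X, mul_zero, mul_zero, add_zero]
  -- some `s ∈ O` sees `W₁` (it is nonzero: entry `(0, j₂)` is `1`)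
  have hW₁entry : W₁ 0 j₂ = 1 := by
    simp [hW₁, b', Ne.symm hj₂1]
  have hex : ∃ s ∈ O, β.g s W₁ ≠ 0 := by
    by_contra hall
    push Not at hall
    have h := eq_sum_off_one β O hO W₁
    have hzero : W₁ = 0 := by
      rw [h]; exact Finset.sum_eq_zero fun s hs => by rw [hall s hs, mul_zero, zero_smul]
    have := hW₁entry
    rw [hzero, Matrix.zero_apply] at this
    exact zero_ne_one this
  obtain ⟨s, hs, hgs⟩ := hex
  refine not_mul_hom_matrix_two (β.f s) (hO' s hs) rfl fun A B => ?_
  have h1 := htrans W₁ hW₁J hW₁bh s hs (A * B)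
  have h2 := htrans (B * W₁) (hmulJ B W₁ hW₁J) (hmulbh B W₁ hW₁bh) s hs A
  have h3 := htrans W₁ hW₁J hW₁bh s hs B
  rw [Matrix.mul_assoc] at h1
  have key : β.f s (A * B) * β.f s 1 * β.g s W₁ = β.f s A * β.f s B * β.g s W₁ := by
    have e1 : β.f s 1 * (β.f s 1 * β.g s (A * (B * W₁))) = β.f s 1 * (β.f s (A * B) * β.g s W₁) := by rw [h1]
    have e2 : β.f s 1 * (β.f s 1 * β.g s (A * (B * W₁))) = β.f s A * (β.f s 1 * β.g s (B * W₁)) := by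
      rw [h2]; ring
    rw [h3] at e2
    linear_combination -e1 + e2
  exact mul_right_cancel₀ hgs key

end CaseB

end Summit.MatrixMultiplication.OmegaCensus.SmallFormats
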